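/-
COR-CM (cell pub-hodgecm2, stage 2 of the Hodge ladder) — count-neutral KERNEL COMBINATORICS «the dihedral law», part II: HODGE VECTORS SUPPORTED
ON THE TWO BASE BLOCKS `B₀ ∪ B₁` OF ARC PAIRS ARE SUMS OF PAIRS (seat prover-pub-hodgecm2-b23-g48-0, binder prover b23, gen 48; claim «DIHEDRAL
LAW», HOME/INBOX.md l.22267).  Theorems only, on parts Ia/Ib (`Census/DihedralDatum.lean`, `Census/DihedralArcPairs.lean`), seat b09ʼs
`typeSum`/`hodgeSpan`/`pairSet` currency and `CyclicCharacter.mem_span_pairSet_of_symm` (`Census/CyclicCharacterArcReduction.lean`), and seat b09ʼs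
`ℤ/2n` lemmas of `Census/QuaternionColumnBiarc.lean`, all BY NAME; no `decide`, no certificate, no named fact, no `sorry`; `Interfaces.lean` (C1),
every E term, B01, `Transposition/*`, `PortJoin/*`, `D2Bridge/*` untouched.
HONEST FRAMING: `HC_CM` is NOT proved, here or anywhere in the tree; nothing here is a period, a count of record or a headline.
T5: n/a-class (hypothesis binders = the fields of `Dihedral.Datum`; checker: self).
-/
import Summits.HodgeConjecture.CorCM.Census.DihedralArcPairs
import Summits.HodgeConjecture.CorCM.Census.CyclicCharacterArcReduction

/-!
# The dihedral law, II: Hodge vectors supported on `B₀ ∪ B₁` are sums of pairs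

THE SETTING of parts Ia/Ib: a dihedral datum `D` for `(G, c)` (`G ≅ D(ℤ/2n)`, `c = gⁿ`), the arc pairs `A(a, b) = arcPair D a b` with block
invariant `d = a + b ∈ ℤ/2n`.  The REDUCTION TARGET of the dihedral law is the union of the two blocks
`B₀ = {A(a, −a)}` and `B₁ = {A(a, 1 − a)}` (`d = 0, 1`; each of `2n` types, each type stabilised by one reflection).

**THEOREM (`mem_span_pairSet_of_support`).**  An integer Hodge vector (constant type sum, e.g. any element of `hodgeSpan`) supported on
`B₀ ∪ B₁` is a sum of pairs `[Ψ] + [Ψ̄]`.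

PROOF — the DOUBLE WINDOW ARGUMENT (§2–§3).  Write `α(a)`, `β(a)` for the coefficients of `A(a, −a)`, `A(a, 1 − a)` and
`W_f(z) = Σ_{a : z ∈ (a, a+n]} f(a)` for the window sums.  The type sum at the rotation `g^z` is `W_α(z) + W_β(z)`, at the reflection `g^z·s` it is
`W_α(n + 1 − z) + W_β(n + 2 − z)` (the reflection parts are the arcs at `−a`, `1 − a`, read through `z ∈ (−a, −a+n] ⟺ n + 1 − z ∈ (a, a+n]`,
b09ʼs `val_sub_lt_iff_reflect`).  Constancy of both gives `W_β(u + 1) = W_β(u)` for all `u`, and a window moved by one step changes by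
`β(u) − β(u − n)` (§2, the end-point flip rule of part Ia): so `β` is `n`-PERIODIC, then so is `α`; and `n`-periodicity of the coefficients is exactly
conjugation symmetry (`A(a,b)·c = A(a+n, b+n)`), i.e. the vector is a sum of pairs (`CyclicCharacter.mem_span_pairSet_of_symm`).
WHY TWO BLOCKS: a single stabilised block can never be a reduction target (seat b09 gen 42ʼs fibre-functional obstruction, HOME/INBOX l.22240) and
`B₀ ∪ B₁ ∪ B₋₁` already carries Hodge vectors that are not pairs (numerically an excess of rank `4` for `D₈`); `B₀ ∪ B₁` is exactly right.

## References
* [Pohlmann1968] H. Pohlmann, Algebraic cycles on abelian varieties of complex multiplication type, Ann. of Math. 88 (1968), Thm 1.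
* [Milne1999] J. S. Milne, Lefschetz motives and the Tate conjecture, Compositio Math. 117 (1999), Prop. 2.1, p. 54.
-/

namespace Summit.HodgeConjecture.CorCM.Census.Dihedral

open Finset
open Summit.HodgeConjecture.CorCM.Prior.AllgGroup.RfwfAllgGroup
open Summit.HodgeConjecture.CorCM.Census.BlockParity
open Summit.HodgeConjecture.CorCM.Census.Coinvariant

noncomputable section

variable {G : Type*} [Group G] [Fintype G] [DecidableEq G] {c : G} {n : ℕ} [NeZero n]
variable (D : Datum G c n)

/-! ## §1 The two base families and their indicators -/

/-- The `d = 0` family is injective in `a`. [folklore] -/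
theorem arcPair_neg_injective : Function.Injective fun a : ZMod (2 * n) => arcPair D a (-a) :=
  fun _ _ h => (arcPair_injective D h).1

/-- The `d = 1` family is injective in `a`. [folklore] -/
theorem arcPair_one_sub_injective : Function.Injective fun a : ZMod (2 * n) => arcPair D a (1 - a) :=
  fun _ _ h => (arcPair_injective D h).1

/-- The two base families are disjoint (`d = 0 ≠ 1` in `ℤ/2n`, `n ≥ 1`). [folklore] -/
theorem arcPair_neg_ne_one_sub (a a' : ZMod (2 * n)) : arcPair D a (-a) ≠ arcPair D a' (1 - a') := by
  intro h
  have e := add_eq_of_arcPair_eq D h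
  have e' : (1 : ZMod (2 * n)) = 0 := by linear_combination -e
  have h1 := congrArg ZMod.val e'
  rw [QuaternionColumn.val_one_eq, ZMod.val_zero] at h1
  exact one_ne_zero h1

/-- The indicator of an arc pair at a rotation. [folklore] -/
theorem indG_arcPair_pow (a b : ZMod (2 * n)) (i : ℕ) :
    indG (arcPair D a b).1 (D.g ^ i) = if ((i : ZMod (2 * n)) - a - 1).val < n then 1 else 0 := by
  unfold indG
  by_cases h : ((i : ZMod (2 * n)) - a - 1).val < n
  · rw [if_pos ((pow_mem_arcPair D a b i).mpr h), if_pos h]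
  · rw [if_neg (fun h' => h ((pow_mem_arcPair D a b i).mp h')), if_neg h]

/-- The indicator of an arc pair at a reflection. [folklore] -/
theorem indG_arcPair_pow_mul_s (a b : ZMod (2 * n)) (i : ℕ) :
    indG (arcPair D a b).1 (D.g ^ i * D.s) = if ((i : ZMod (2 * n)) - b - 1).val < n then 1 else 0 := by
  unfold indG
  by_cases h : ((i : ZMod (2 * n)) - b - 1).val < n
  · rw [if_pos ((pow_mul_s_mem_arcPair D a b i).mpr h), if_pos h]
  · rw [if_neg (fun h' => h ((pow_mul_s_mem_arcPair D a b i).mp h')), if_neg h]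

/-! ## §2 Windows of `ℤ/2n` -/

/-- **Moving a window by one step**: `Σ_{a ∈ (z, z+1+… ]}` — precisely
`Σ_a [ (z − a).val < n ] f(a) − Σ_a [ (z − a − 1).val < n ] f(a) = f(z) − f(z − n)`. [folklore] -/
theorem window_step (f : ZMod (2 * n) → ℤ) (z : ZMod (2 * n)) :
    (∑ a, if (z - a).val < n then f a else 0) - (∑ a, if (z - a - 1).val < n then f a else 0) = f z - f (z - n) := by
  have hn : 1 ≤ n := Nat.one_le_iff_ne_zero.mpr (NeZero.ne n)
  rw [← Finset.sum_sub_distrib]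
  have hterm : ∀ a : ZMod (2 * n), ((if (z - a).val < n then f a else 0) - if (z - a - 1).val < n then f a else 0) =
      (if a = z then f a else 0) - if a = z - n then f a else 0 := by
    intro a
    have key := val_lt_iff_not_iff hn (z - a)
    have e1 : (z - a = 0) ↔ a = z := by rw [sub_eq_zero, eq_comm]
    have e2 : (z - a = (n : ZMod (2 * n))) ↔ a = z - n := by
      constructor
      · intro h; rw [← h]; ring
      · intro h; rw [h]; ring
    rw [e1, e2] at key
    have hnval : ((n : ZMod (2 * n))).val = n := by rw [ZMod.val_natCast, Nat.mod_eq_of_lt (by omega)]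
    by_cases h3 : a = z
    · have h4 : a ≠ z - n := by
        intro h4; rw [h3] at h4
        exact QuaternionColumn.natCast_n_ne_zero (n := n) (by linear_combination h4)
      have hP1 : (z - a).val < n := by rw [h3, sub_self, ZMod.val_zero]; omega
      have hP2 : ¬ (z - a - 1).val < n := fun hP2 => (key.mp hP1) ⟨fun _ => Or.inl h3, fun _ => hP2⟩
      rw [if_pos hP1, if_neg hP2, if_pos h3, if_neg h4]
    · by_cases h4 : a = z - n
      · have hP1 : ¬ (z - a).val < n := by
          rw [h4, show z - (z - (n : ZMod (2 * n))) = n by ring, hnval]; omega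
        have hP2 : (z - a - 1).val < n := by
          by_contra hP2
          exact hP1 (key.mpr fun hiff => hP2 (hiff.mpr (Or.inr h4)))
        rw [if_neg hP1, if_pos hP2, if_neg h3, if_pos h4]
      · have hiff : (z - a).val < n ↔ (z - a - 1).val < n := by
          rw [key]
          constructor
          · intro h; by_contra hP2; exact h ⟨fun hP2' => absurd hP2' hP2, fun h34 => h34.elim (fun h => absurd h h3) fun h => absurd h h4⟩
          · intro hP2 hiff'; exact (hiff'.mp hP2).elim h3 h4
        by_cases hP2 : (z - a - 1).val < n
        · rw [if_pos (hiff.mpr hP2), if_pos hP2, if_neg h3, if_neg h4, sub_self, sub_self]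
        · rw [if_neg (fun h => hP2 (hiff.mp h)), if_neg hP2, if_neg h3, if_neg h4]
  simp only [hterm, Finset.sum_sub_distrib, Finset.sum_ite_eq', Finset.mem_univ, if_true]

/-- **A periodic step forces periodic coefficients**: if the two windows agree everywhere, `f(a + n) = f(a)` for all `a`. [folklore] -/
theorem periodic_of_window (f : ZMod (2 * n) → ℤ)
    (h : ∀ z : ZMod (2 * n), (∑ a, if (z - a).val < n then f a else 0) = ∑ a, if (z - a - 1).val < n then f a else 0) (a : ZMod (2 * n)) :
    f (a + n) = f a := by
  have hs := window_step f (a + n)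
  rw [h (a + n), sub_self] at hs
  have e : a + (n : ZMod (2 * n)) - n = a := by ring
  rw [e] at hs
  linarith

/-- The reflection of a window: `z ∈ (−a', −a'+n] ⟺ n + 1 − z ∈ (a', a'+n]`, in values: `(z + a' − 1).val < n ↔ ((n + 1 − z) − a' − 1).val < n`.
[folklore] -/
theorem val_lt_reflect (z a' : ZMod (2 * n)) : (z - -a' - 1).val < n ↔ (((n : ZMod (2 * n)) + 1 - z) - a' - 1).val < n := by
  have h := QuaternionColumn.val_sub_lt_iff_reflect (z - 1) (-a') (0 : ZMod (2 * n))
  have e1 : z - 1 - -a' - 0 = z - -a' - 1 := by ring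
  have e2 : -a' - (z - 1 - 0 + (n : ZMod (2 * n)) + 1) = ((n : ZMod (2 * n)) + 1 - z) - a' - 1 := by
    linear_combination (-1 : ZMod (2 * n)) * QuaternionColumn.two_n_eq_zero (n := n)
  rw [e1, e2] at h
  exact h

/-! ## §3 The double window argument -/

/-- **Type sums of a vector supported on `B₀ ∪ B₁`**, at a rotation `g^i`: `W_α(i) + W_β(i)`. [folklore] -/
theorem typeSum_pow_of_support (y : CMF G c →₀ ℤ)
    (hsupp : ∀ Ψ ∈ y.support, ∃ a : ZMod (2 * n), Ψ = arcPair D a (-a) ∨ Ψ = arcPair D a (1 - a)) (i : ℕ) :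
    typeSum G c y (D.g ^ i) =
      (∑ a : ZMod (2 * n), if ((i : ZMod (2 * n)) - a - 1).val < n then y (arcPair D a (-a)) else 0) +
        ∑ a : ZMod (2 * n), if ((i : ZMod (2 * n)) - a - 1).val < n then y (arcPair D a (1 - a)) else 0 := by
  classical
  rw [CyclicFaces.typeSum_apply_eq_sum]
  set R₀ : Finset (CMF G c) := univ.image fun a : ZMod (2 * n) => arcPair D a (-a)
  set R₁ : Finset (CMF G c) := univ.image fun a : ZMod (2 * n) => arcPair D a (1 - a)
  have hsub : y.support ⊆ R₀ ∪ R₁ := by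
    intro Ψ hΨ
    obtain ⟨a, h | h⟩ := hsupp Ψ hΨ
    · exact mem_union_left _ (mem_image.mpr ⟨a, mem_univ _, h.symm⟩)
    · exact mem_union_right _ (mem_image.mpr ⟨a, mem_univ _, h.symm⟩)
  have hdisj : Disjoint R₀ R₁ := by
    rw [Finset.disjoint_left]
    intro Ψ h0 h1
    obtain ⟨a, -, rfl⟩ := mem_image.mp h0
    obtain ⟨a', -, h⟩ := mem_image.mp h1
    exact arcPair_neg_ne_one_sub D a a' h.symm
  rw [Finset.sum_subset hsub (fun Ψ _ hΨ => by rw [Finsupp.notMem_support_iff.mp hΨ, zero_mul]), Finset.sum_union hdisj,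
    Finset.sum_image fun a _ b _ h => arcPair_neg_injective D h, Finset.sum_image fun a _ b _ h => arcPair_one_sub_injective D h]
  congr 1
  · refine Finset.sum_congr rfl fun a _ => ?_
    rw [indG_arcPair_pow, mul_ite, mul_one, mul_zero]
  · refine Finset.sum_congr rfl fun a _ => ?_
    rw [indG_arcPair_pow, mul_ite, mul_one, mul_zero]

/-- **Type sums of a vector supported on `B₀ ∪ B₁`**, at a reflection `g^i·s`: `W_α(n + 1 − i) + W_β(n + 2 − i)`. [folklore] -/
theorem typeSum_pow_mul_s_of_support (y : CMF G c →₀ ℤ)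
    (hsupp : ∀ Ψ ∈ y.support, ∃ a : ZMod (2 * n), Ψ = arcPair D a (-a) ∨ Ψ = arcPair D a (1 - a)) (i : ℕ) :
    typeSum G c y (D.g ^ i * D.s) =
      (∑ a : ZMod (2 * n), if (((n : ZMod (2 * n)) + 1 - (i : ZMod (2 * n))) - a - 1).val < n then y (arcPair D a (-a)) else 0) +
        ∑ a : ZMod (2 * n), if (((n : ZMod (2 * n)) + 1 - (i : ZMod (2 * n)) + 1) - a - 1).val < n then y (arcPair D a (1 - a)) else 0 := by
  classical
  rw [CyclicFaces.typeSum_apply_eq_sum]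
  set R₀ : Finset (CMF G c) := univ.image fun a : ZMod (2 * n) => arcPair D a (-a)
  set R₁ : Finset (CMF G c) := univ.image fun a : ZMod (2 * n) => arcPair D a (1 - a)
  have hsub : y.support ⊆ R₀ ∪ R₁ := by
    intro Ψ hΨ
    obtain ⟨a, h | h⟩ := hsupp Ψ hΨ
    · exact mem_union_left _ (mem_image.mpr ⟨a, mem_univ _, h.symm⟩)
    · exact mem_union_right _ (mem_image.mpr ⟨a, mem_univ _, h.symm⟩)
  have hdisj : Disjoint R₀ R₁ := by
    rw [Finset.disjoint_left]
    intro Ψ h0 h1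
    obtain ⟨a, -, rfl⟩ := mem_image.mp h0
    obtain ⟨a', -, h⟩ := mem_image.mp h1
    exact arcPair_neg_ne_one_sub D a a' h.symm
  rw [Finset.sum_subset hsub (fun Ψ _ hΨ => by rw [Finsupp.notMem_support_iff.mp hΨ, zero_mul]), Finset.sum_union hdisj,
    Finset.sum_image fun a _ b _ h => arcPair_neg_injective D h, Finset.sum_image fun a _ b _ h => arcPair_one_sub_injective D h]
  congr 1
  · refine Finset.sum_congr rfl fun a _ => ?_
    rw [indG_arcPair_pow_mul_s, mul_ite, mul_one, mul_zero]
    exact if_congr (val_lt_reflect _ _) rfl rfl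
  · refine Finset.sum_congr rfl fun a _ => ?_
    rw [indG_arcPair_pow_mul_s, mul_ite, mul_one, mul_zero]
    have e : ((i : ZMod (2 * n)) - (1 - a) - 1) = ((i : ZMod (2 * n)) - 1) - -a - 1 := by ring
    have e' : ((n : ZMod (2 * n)) + 1 - ((i : ZMod (2 * n)) - 1)) - a - 1 = ((n : ZMod (2 * n)) + 1 - (i : ZMod (2 * n)) + 1) - a - 1 := by ring
    exact if_congr (by rw [e, val_lt_reflect, e']) rfl rfl

/-- **THE DOUBLE WINDOW ARGUMENT.**  If `y` is supported on `B₀ ∪ B₁` and has constant type sum, then its coefficients are `n`-periodic: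
`y(A(a+n, −(a+n))) = y(A(a, −a))` and `y(A(a+n, 1−(a+n))) = y(A(a, 1−a))`. [folklore] -/
theorem periodic_of_typeSum_const (y : CMF G c →₀ ℤ)
    (hsupp : ∀ Ψ ∈ y.support, ∃ a : ZMod (2 * n), Ψ = arcPair D a (-a) ∨ Ψ = arcPair D a (1 - a))
    (hk : ∃ k : ℤ, ∀ x : G, typeSum G c y x = k) (a : ZMod (2 * n)) :
    y (arcPair D (a + n) (-(a + n))) = y (arcPair D a (-a)) ∧ y (arcPair D (a + n) (1 - (a + n))) = y (arcPair D a (1 - a)) := by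
  obtain ⟨k, hk⟩ := hk
  set α : ZMod (2 * n) → ℤ := fun a => y (arcPair D a (-a)) with hα
  set β : ZMod (2 * n) → ℤ := fun a => y (arcPair D a (1 - a)) with hβ
  -- the two window identities, as functions of `z : ℤ/2n`
  have hrot : ∀ z : ZMod (2 * n), (∑ a, if (z - a - 1).val < n then α a else 0) + (∑ a, if (z - a - 1).val < n then β a else 0) = k := by
    intro z
    have h := typeSum_pow_of_support D y hsupp z.val
    rw [ZMod.natCast_zmod_val, hk] at h
    exact h.symm
  have hrefl : ∀ u : ZMod (2 * n), (∑ a, if (u - a - 1).val < n then α a else 0) + (∑ a, if (u + 1 - a - 1).val < n then β a else 0) = k := by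
    intro u
    have h := typeSum_pow_mul_s_of_support D y hsupp ((n : ZMod (2 * n)) + 1 - u).val
    rw [ZMod.natCast_zmod_val, hk] at h
    have e : (n : ZMod (2 * n)) + 1 - ((n : ZMod (2 * n)) + 1 - u) = u := by ring
    rw [e] at h
    exact h.symm
  -- β is periodic
  have hβstep : ∀ z : ZMod (2 * n), (∑ a, if (z - a).val < n then β a else 0) = ∑ a, if (z - a - 1).val < n then β a else 0 := by
    intro z
    have h1 := hrot z
    have h2 := hrefl z
    have e : ∀ a : ZMod (2 * n), z + 1 - a - 1 = z - a := fun a => by ring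
    simp only [e] at h2
    linarith
  have hβper : ∀ a : ZMod (2 * n), β (a + n) = β a := periodic_of_window β hβstep
  -- α is periodic: W_α(z+1) − W_α(z) = −(W_β(z+1) − W_β(z)) = 0
  have hαstep : ∀ z : ZMod (2 * n), (∑ a, if (z - a).val < n then α a else 0) = ∑ a, if (z - a - 1).val < n then α a else 0 := by
    intro z
    have h1 := hrot z
    have h2 := hrot (z + 1)
    have h3 := hβstep z
    have e : ∀ a : ZMod (2 * n), z + 1 - a - 1 = z - a := fun a => by ring
    simp only [e] at h2
    linarith
  have hαper : ∀ a : ZMod (2 * n), α (a + n) = α a := periodic_of_window α hαstep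
  exact ⟨hαper a, by
    have h := hβper a
    simp only [hβ] at h
    exact h⟩

/-- **THEOREM (Hodge vectors on `B₀ ∪ B₁` are pairs).**  A vector with constant type sum supported on the arc pairs `A(a, −a)`, `A(a, 1 − a)`
lies in `ℤ⟨pairs⟩`. [folklore] -/
theorem mem_span_pairSet_of_support (hc2 : c * c = 1) (y : CMF G c →₀ ℤ)
    (hsupp : ∀ Ψ ∈ y.support, ∃ a : ZMod (2 * n), Ψ = arcPair D a (-a) ∨ Ψ = arcPair D a (1 - a))
    (hk : ∃ k : ℤ, ∀ x : G, typeSum G c y x = k) : y ∈ Submodule.span ℤ (pairSet c) := by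
  haveI : Fintype (CMF G c) := Fintype.ofFinite _
  refine CyclicCharacter.mem_span_pairSet_of_symm hc2 y fun Ψ => ?_
  by_cases hΨ : Ψ ∈ y.support
  · obtain ⟨a, rfl | rfl⟩ := hsupp Ψ hΨ
    · rw [rt_c_arcPair, show -a + (n : ZMod (2 * n)) = -(a + n) by
        linear_combination QuaternionColumn.two_n_eq_zero (n := n)]
      exact (periodic_of_typeSum_const D y hsupp hk a).1
    · rw [rt_c_arcPair, show 1 - a + (n : ZMod (2 * n)) = 1 - (a + n) by
        linear_combination QuaternionColumn.two_n_eq_zero (n := n)]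
      exact (periodic_of_typeSum_const D y hsupp hk a).2
  · -- off the support: both coefficients vanish (the support is conjugation-stable)
    rw [Finsupp.notMem_support_iff.mp hΨ]
    by_contra hne
    have hmem : rt c c Ψ ∈ y.support := Finsupp.mem_support_iff.mpr hne
    obtain ⟨a, h | h⟩ := hsupp _ hmem
    · apply hΨ
      have e : Ψ = arcPair D (a + n) (-(a + n)) := by
        have h2 : rt c c (rt c c Ψ) = Ψ := by rw [← rt_mul, hc2, rt_one]
        rw [← h2, h, rt_c_arcPair]
        congr 1
        linear_combination QuaternionColumn.two_n_eq_zero (n := n)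
      rw [e]
      have hp := (periodic_of_typeSum_const D y hsupp hk a).1
      rw [Finsupp.mem_support_iff, hp, ← h]
      exact hne
    · apply hΨ
      have e : Ψ = arcPair D (a + n) (1 - (a + n)) := by
        have h2 : rt c c (rt c c Ψ) = Ψ := by rw [← rt_mul, hc2, rt_one]
        rw [← h2, h, rt_c_arcPair]
        congr 1
        linear_combination QuaternionColumn.two_n_eq_zero (n := n)
      rw [e]
      have hp := (periodic_of_typeSum_const D y hsupp hk a).2
      rw [Finsupp.mem_support_iff, hp, ← h]
      exact hne

/-- **COROLLARY (for `hodgeSpan`).**  Every element of `hodgeSpan` supported on `B₀ ∪ B₁` is a sum of pairs. [folklore] -/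
theorem mem_span_pairSet_of_mem_hodgeSpan (hc2 : c * c = 1) {y : CMF G c →₀ ℤ} (hy : y ∈ hodgeSpan c hc2)
    (hsupp : ∀ Ψ ∈ y.support, ∃ a : ZMod (2 * n), Ψ = arcPair D a (-a) ∨ Ψ = arcPair D a (1 - a)) :
    y ∈ Submodule.span ℤ (pairSet c) :=
  mem_span_pairSet_of_support D hc2 y hsupp (exists_forall_typeSum_eq_of_mem_hodgeSpan c hc2 D.hcen hy)

end

end Summit.HodgeConjecture.CorCM.Census.Dihedral
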